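import Literature.Geometry.Lorentzian.CoordRicciEigenframe
import Mathlib.LinearAlgebra.Determinant
import HarnessLib

/-!
# The determinant of the Ricci operator in coordinates

For metric components `G` (the `MetricCoord` layer of `CoordCurvature.lean`) the **determinant of
the Ricci operator** `det(♯∘Ric)` at a point (`ricDetAt`), the smooth non-negative function whose
zero set is `{λ_min(Ric) = 0}` on a manifold with `Ric ≥ 0`; it is the barrier used to exclude the
degenerate case of the classification of compact three-dimensional shrinking Ricci solitons
(Eminenti–La Nave–Mantegazza 2008, §3, second case) by E. Hopf's minimum principle. We prove:

* `toMatrix_sharpAt_comp_of_orthonormal` — in a `G_y`-orthonormal basis the operator `♯∘β` of a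
  form `β` has matrix `(β(e_j, e_i))`; hence `ricDetAt_eq_det_of_orthonormal`:
  `det(♯Ric) = det (Ric(eᵢ,eⱼ))`, also for orthonormal FAMILIES of full cardinality
  (`ricDetAt_eq_det_of_orthonormal_family`, the parallel frames of `CoordParallelFrames.lean`);
* `ricDetAt_eq_prod_of_eigenframe` — in an orthonormal eigenframe `det(♯Ric) = Π μᵢ`;
* `IsMetricOn.contDiffOn_ricDetAt_three` — smoothness in dimension three (the determinant written
  out with `Matrix.det_fin_three`).

One definition (`ricDetAt`, with body) is introduced; no statement of `Prop` type.

## References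

* B. O'Neill, *Semi-Riemannian geometry*, 1983, Ch. 2, Lemma 2.25; Ch. 3, Lemma 3.52. [ONeill1983]
* M. Eminenti, G. La Nave, C. Mantegazza, manuscripta math. 127 (2008), §3. [EminentiLanaveMantegazza2008]
-/

noncomputable section

set_option maxSynthPendingDepth 3

open Set Module Matrix
open scoped Topology ContDiff

namespace Literature.Geometry.Lorentzian

namespace MetricCoord

variable {E : Type*} [NormedAddCommGroup E] [NormedSpace ℝ E] [FiniteDimensional ℝ E]
  (G : E → E →L[ℝ] E →L[ℝ] ℝ) {V : Set E} {y : E}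

/-- The **determinant of the Ricci operator** `♯_y ∘ Ric_y : E → E` of metric components `G` at
`y` (the product of the eigenvalues of `Ric_y` relative to `G_y`). [cite: ONeill1983, Ch. 3, Lemma 3.52] -/
def ricDetAt (y : E) : ℝ :=
  LinearMap.det (((sharpAt G y).comp (ricAt G y) : E →L[ℝ] E) : E →ₗ[ℝ] E)

/-- Unfolding lemma for `ricDetAt`. [folklore] -/
theorem ricDetAt_def (y : E) :
    ricDetAt G y = LinearMap.det (((sharpAt G y).comp (ricAt G y) : E →L[ℝ] E) : E →ₗ[ℝ] E) := rfl

variable {G}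

section Orthonormal

variable {ι : Type*} [Fintype ι] [DecidableEq ι]
  (e : Basis ι ℝ E) (he : ∀ i j, G y (e i) (e j) = if i = j then 1 else 0)
include he

omit [FiniteDimensional ℝ E] in
/-- **The matrix of `♯∘β` in an orthonormal basis** is `(β(e_j, e_i))_{ij}`.
[cite: ONeill1983, Ch. 2, Lemma 2.25] -/
theorem toMatrix_sharpAt_comp_of_orthonormal (hi : (G y).IsInvertible) (β : E →L[ℝ] E →L[ℝ] ℝ) :
    LinearMap.toMatrix e e (((sharpAt G y).comp β : E →L[ℝ] E) : E →ₗ[ℝ] E) =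
      Matrix.of fun i j ↦ β (e j) (e i) := by
  ext i j
  rw [LinearMap.toMatrix_apply, Matrix.of_apply, ← Basis.coord_apply,
    coord_eq_apply_of_orthonormal e he, ContinuousLinearMap.coe_coe, ContinuousLinearMap.comp_apply,
    apply_sharpAt_apply hi]

/-- **`det(♯Ric) = det (Ric(eᵢ,eⱼ))`** in a `G_y`-orthonormal basis. [cite: ONeill1983, Ch. 3, Lemma 3.52] -/
theorem ricDetAt_eq_det_of_orthonormal (hi : (G y).IsInvertible) :
    ricDetAt G y = Matrix.det (Matrix.of fun i j ↦ ricAt G y (e i) (e j)) := by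
  rw [ricDetAt_def, ← LinearMap.det_toMatrix e, toMatrix_sharpAt_comp_of_orthonormal e he hi,
    ← Matrix.det_transpose]
  congr 1

/-- **`det(♯Ric) = Π μᵢ`** in an orthonormal eigenframe `Ric(eᵢ,·) = μᵢ G(eᵢ,·)`.
[cite: ONeill1983, Ch. 3, Lemma 3.52] -/
theorem ricDetAt_eq_prod_of_eigenframe (hi : (G y).IsInvertible) {μ : ι → ℝ}
    (hμ : ∀ i w, ricAt G y (e i) w = μ i * G y (e i) w) : ricDetAt G y = ∏ i, μ i := by
  rw [ricDetAt_eq_det_of_orthonormal e he hi]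
  have hM : (Matrix.of fun i j ↦ ricAt G y (e i) (e j)) = Matrix.diagonal μ := by
    ext i j
    rw [Matrix.of_apply, ricAt_eigenframe_apply e he hμ, Matrix.diagonal_apply]
  rw [hM, Matrix.det_diagonal]

end Orthonormal

/-- **`det(♯Ric) = det (Ric(Wᵢ,Wⱼ))` for an orthonormal family of full cardinality** (e.g. a
parallel frame along a geodesic, `CoordParallelFrames.lean`). [cite: ONeill1983, Ch. 3, Lemma 3.52] -/
theorem ricDetAt_eq_det_of_orthonormal_family {ι : Type*} [Fintype ι] [DecidableEq ι]
    {W : ι → E} (hW : ∀ i j, G y (W i) (W j) = if i = j then 1 else 0)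
    (hcard : Fintype.card ι = finrank ℝ E) (hi : (G y).IsInvertible) :
    ricDetAt G y = Matrix.det (Matrix.of fun i j ↦ ricAt G y (W i) (W j)) := by
  -- the family is a basis
  have hli : LinearIndependent ℝ W := by
    rw [Fintype.linearIndependent_iff]
    intro c hc i
    have h := congrArg (fun v ↦ G y v (W i)) hc
    simp only [map_sum, map_smul, FunLike.coe_sum, Finset.sum_apply, FunLike.coe_smul,
      Pi.smul_apply, smul_eq_mul, hW, mul_ite, mul_one, mul_zero, Finset.sum_ite_eq',
      Finset.mem_univ, if_true, map_zero, _root_.zero_apply] at h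
    exact h
  have hspan : ⊤ ≤ Submodule.span ℝ (Set.range W) := (hli.span_eq_top_of_card_eq_finrank' hcard).ge
  have h := ricDetAt_eq_det_of_orthonormal (Basis.mk hli hspan) (fun i j ↦ by
    rw [Basis.coe_mk]; exact hW i j) hi
  simpa only [Basis.coe_mk] using h

/-! ### Smoothness in dimension three -/

variable [CompleteSpace E]

/-- The entries of the Ricci operator in a fixed basis are smooth. [folklore] -/
theorem IsMetricOn.contDiffOn_coord_sharpAt_ricAt {ι : Type*} [Fintype ι] (hG : IsMetricOn G V)
    (b : Basis ι ℝ E) (i j : ι) :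
    ContDiffOn ℝ ∞ (fun y ↦ b.coord i (sharpAt G y (ricAt G y (b j)))) V := by
  have h1 : ContDiffOn ℝ ∞ (fun y ↦ sharpAt G y (ricAt G y (b j))) V :=
    hG.contDiffOn_sharpAt.clm_apply (hG.contDiffOn_ricAt.clm_apply contDiffOn_const)
  exact (coordCLM b i).contDiff.comp_contDiffOn h1

/-- **`det(♯Ric)` is smooth** (dimension three; the determinant written out in a fixed basis with
`Matrix.det_fin_three`). [folklore] -/
theorem IsMetricOn.contDiffOn_ricDetAt_three (hG : IsMetricOn G V) (h3 : finrank ℝ E = 3) :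
    ContDiffOn ℝ ∞ (ricDetAt G) V := by
  set b : Basis (Fin 3) ℝ E := Module.finBasisOfFinrankEq ℝ E h3 with hb
  set m : Fin 3 → Fin 3 → E → ℝ := fun i j y ↦ b.coord i (sharpAt G y (ricAt G y (b j))) with hm
  have hmd : ∀ i j, ContDiffOn ℝ ∞ (m i j) V := fun i j ↦ hG.contDiffOn_coord_sharpAt_ricAt b i j
  have hfun : ricDetAt G = fun y ↦
      m 0 0 y * m 1 1 y * m 2 2 y - m 0 0 y * m 1 2 y * m 2 1 y
      - m 0 1 y * m 1 0 y * m 2 2 y + m 0 1 y * m 1 2 y * m 2 0 y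
      + m 0 2 y * m 1 0 y * m 2 1 y - m 0 2 y * m 1 1 y * m 2 0 y := by
    funext y
    rw [ricDetAt_def, ← LinearMap.det_toMatrix b, Matrix.det_fin_three]
    simp only [LinearMap.toMatrix_apply, ContinuousLinearMap.coe_coe, ContinuousLinearMap.comp_apply,
      hm, Basis.coord_apply]
  rw [hfun]
  exact ((((((hmd 0 0).mul (hmd 1 1)).mul (hmd 2 2)).sub (((hmd 0 0).mul (hmd 1 2)).mul (hmd 2 1))).sub
    (((hmd 0 1).mul (hmd 1 0)).mul (hmd 2 2))).add (((hmd 0 1).mul (hmd 1 2)).mul (hmd 2 0))).add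
    (((hmd 0 2).mul (hmd 1 0)).mul (hmd 2 1)) |>.sub (((hmd 0 2).mul (hmd 1 1)).mul (hmd 2 0))

end MetricCoord

end Literature.Geometry.Lorentzian

end
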